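import Summits.QuantumAdvantage.QuantumAdvantage.Theorems.CubicForrelationNearExactIsExactTenPeel

/-!
# Crux `CubicForrelation.NearExactIsExact` (stmt-QuantumAdvantage-14043), line `direct-sum-amplification`, lead c6:
  stub `stub_cellDecomposition` — the Walsh transform of a 10-bit function of unbalanced-split normal form, cell by cell

If `g(w ‖ a₀ ‖ b₀) = E(w) ⊕ (a₀ ∧ D w) ⊕ (b₀ ∧ (Q w ⊕ ε))` (`Fin.snoc` twice: `w ∈ 𝔽₂⁸`, then `a₀`, then `b₀`), then for
every `x ∈ 𝔽₂⁸` and bits `a b`,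
`W_g(x ‖ a ‖ b) = 4 · Σ_{w : D w = a, Q w ⊕ ε = b} (−1)^{E w} (−1)^{w·x}`:
the Walsh transform at `x ‖ a ‖ b` only sees the cell `{D = a} ∩ {Q ⊕ ε = b}` of `𝔽₂⁸`.
Used by the lead to reduce the `n = 10` window at `θ = 7/8` (unbalanced split) to a finite census over the cells.

Proof. Split the sum over `y ∈ 𝔽₂¹⁰` along the last two coordinates (`SgnForrMem.sum_snoc` twice), factor the
character (`twist_snoc` twice: `(−1)^{(w‖a₀‖b₀)·(x‖a‖b)} = (−1)^{w·x} (−1)^{a₀ a} (−1)^{b₀ b}`), and evaluate the sum over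
`(a₀, b₀) ∈ 𝔽₂²` in closed form (`cd_bool_sum`, a 32-case Boolean identity:
`Σ_{a₀} (−1)^{a₀ d} (−1)^{a₀ a} = 2·[d = a]` and `Σ_{b₀} (−1)^{b₀ q} (−1)^{b₀ b} = 2·[q = b]`).
Sources: R. O'Donnell, *Analysis of Boolean Functions*, CUP 2014, §1.4 (characters factor over coordinates; orthogonality
of characters on `𝔽₂`). Everything below is proved from Mathlib and the tree (`W`, `SgnForrMem.sum_snoc`, `twist_snoc`);
axioms are the standard three.
-/

set_option linter.dupNamespace false -- D-0017: single-problem summit ⇒ `QuantumAdvantage.QuantumAdvantage` by design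

noncomputable section

namespace Summit.QuantumAdvantage.QuantumAdvantage.Theorems.CubicForrelation.NearExactIsExact

open Finset
open Literature.Computability.QuantumComplexity
open Literature.Computability.QuantumComplexity.DerivativeWalsh (W)

/-! ### The two-bit character sum -/

/-- The closed form of the sum over the last two bits: for Booleans `e d q a b` and a real weight `t`,
`Σ_{a₀ b₀} (−1)^{e ⊕ a₀d ⊕ b₀q} · t (−1)^{a₀ a} (−1)^{b₀ b} = 4 · [d = a] · [q = b] · (−1)^{e} t`
(the `a₀`-sum is `2·[d = a]`, the `b₀`-sum is `2·[q = b]`). -/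
theorem cd_bool_sum (e d q a b : Bool) (t : ℝ) :
    ∑ a₀ : Bool, ∑ b₀ : Bool,
        signOf (e ^^ (a₀ && d) ^^ (b₀ && q)) * (t * signOf (a₀ && a) * signOf (b₀ && b)) =
      4 * (if (d = a ∧ q = b) then signOf e * t else 0) := by
  simp only [Fintype.sum_bool]
  cases e <;> cases d <;> cases q <;> cases a <;> cases b <;> norm_num [signOf] <;> ring

/-! ### The stub -/

/-- **Cell decomposition of the Walsh transform (unbalanced split).**  If
`g(w ‖ a₀ ‖ b₀) = E(w) ⊕ (a₀ ∧ D w) ⊕ (b₀ ∧ (Q w ⊕ ε))` then for every `x ∈ 𝔽₂⁸` and bits `a b`,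
`W_g(x ‖ a ‖ b) = 4 · Σ_{w : D w = a, Q w ⊕ ε = b} (−1)^{E w} (−1)^{w·x}`.
[elementary character sums; R. O'Donnell, *Analysis of Boolean Functions*, CUP 2014, §1.4] -/
theorem stub_cellDecomposition :
    ∀ (E D Q : (Fin (4 + 4) → Bool) → Bool) (ε : Bool) (g : (Fin (4 + 4 + 1 + 1) → Bool) → Bool),
      (∀ (w : Fin (4 + 4) → Bool) (a₀ b₀ : Bool),
        g (Fin.snoc (Fin.snoc w a₀) b₀) = (E w ^^ (a₀ && D w) ^^ (b₀ && (Q w ^^ ε)))) →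
      ∀ (x : Fin (4 + 4) → Bool) (a b : Bool),
        W (fun y => signOf (g y)) (Fin.snoc (Fin.snoc x a) b) =
          4 * ∑ w : Fin (4 + 4) → Bool, if (D w = a ∧ (Q w ^^ ε) = b) then signOf (E w) * twist w x else 0 := by
  intro E D Q ε g hg x a b
  unfold W
  rw [SgnForrMem.sum_snoc (m := 4 + 4 + 1), SgnForrMem.sum_snoc (m := 4 + 4), mul_sum]
  refine sum_congr rfl fun w _ => ?_
  simp only [hg, twist_snoc]
  exact cd_bool_sum (E w) (D w) (Q w ^^ ε) a b (twist w x)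

end Summit.QuantumAdvantage.QuantumAdvantage.Theorems.CubicForrelation.NearExactIsExact
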